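import Summits.QuantumFields.YangMills.Theses.LuscherReduction
import Summits.QuantumFields.YangMills.Theorems.LuscherReductionRunningReductionBOHandoverLabels
import Summits.QuantumFields.YangMills.Theorems.LuscherReductionOneSiteLevelsOfAL1
import Literature.Analysis.OperatorTheory.YangMillsMatrixModelMinMax

/-!
# Crux RED, line «KTR»: the fixed-lattice stub 3b′ `CoarseNoIntruderAt L0` REDUCED to a lattice-only
# Born–Oppenheimer comparison `BO(L0)` plus crux ONE (hence plus the named fact AL1), kernel-checked

Fleet-lead module of seat ym-luscher-20007-p1 g3 for `stmt-QuantumFields-19978` (route `LuscherReduction`, crux RED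
`RunningReduction`, line of record «KTR» rev 3, registered stub `stub_coarseNoIntruderAt2 : KTCoarseHandover.CoarseNoIntruderAt 2`).

The registered stub 3b′ (owner/ideator: "L, finite-dimensional, ONE-free") is an UPPER bound on `λ_k/λ_0` of the zero-flux transfer
operator of the `L0³` lattice (`SU(2)^{3L0³}`, `L0 = 2`: 72 link dimensions, 24 gauge, 6 slow = the 9 constant modes mod `SO(3)`,
42 stiff) as `β → ∞`, at relative precision `o(1)` on the gap `Δ_k`.  Any direct proof contains, as its slow factor, the comparison of
the constant-mode dynamics with Lüscher's `𝔥` — i.e. crux ONE's INNER comparison (flat Kac against `𝔥`, consuming the eigenfunction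
family AL1).  This file SPLITS 3b′ along that seam and PROVES the glue:

* `BO(L0)` (inline hypothesis `hBO`, LATTICE-ONLY, compact-operator currency, no `𝔥`, no AL1): for every `k` and `ε > 0`, for `β ≥ β₀`,
  `λ_k(L0,β) · μ_0(L0³β) ≤ e^{ε λ_b(L0³β)} · μ_k(L0³β) · λ_0(L0,β)` — the `L0³`-lattice spectral ratio is bounded by the ONE-SITE ratio at
  the NATURAL coupling `B' = L0³β` (the `L0³` kernel restricted to spatially constant configurations IS the one-site kernel at `L0³β`),
  up to `e^{o(λ_b)}` (Born–Oppenheimer for the 42 stiff modes; precision margin `β^{-1/6}`);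
* crux ONE `Theses.LuscherReduction.OneSiteLevels` at `B' = L0³β` supplies `μ_k ≤ e^{−(Δ_k λ_b' − C λ_b'²)} μ_0`, `λ_b' = bareLambda(L0³β)`;
* the LABEL LEMMAS of `LuscherReductionRunningReductionBOHandoverLabels.lean` convert the bare one-site parameter into the route's running label: in the window,
  `L0 · bareLambda(L0³β) ≤ luscherLambda β L0` always (`invRunningCoupling β L0 ≤ β/2`), and
  `luscherLambda β L0 ≤ (1+η) · L0 · bareLambda(L0³β)` for `β ≥ β₁(η)` (the two-loop logarithms are `o(β)`), so the mismatch is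
  absorbed by the room `d < Δ_k`.

Results (all sorry-free, standard axioms):
`coarseNoIntruderAt_of_boUpper : BO(L0) → OneSiteLevels → ⟨text of CoarseNoIntruderAt L0⟩`,
`coarseNoIntruderAt_of_boUpper_AL1 : BO(L0) → (∀ k, LuscherHamiltonianEigenfunctions k) → ⟨same⟩` (via the tree's conditional closure
`oneSiteLevels_of_AL1`, p493257), and the converse-direction twin `coarseLowerAt_of_boLower(_AL1)` for `CoarseLowerAt L0`
(the trial-function direction of Born–Oppenheimer).  The conclusions are the VERBATIM bodies of `KTCoarseHandover.CoarseNoIntruderAt L0` /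
`CoarseLowerAt L0` of `Lines-KTR-r3.lean` (the skeleton lives in a Cruxes/pub file and is not importable from `Theorems/`); in the skeleton,
`stub_coarseNoIntruderAt2 := coarseNoIntruderAt_of_boUpper_AL1 2 hBO hAL1` closes 3b′ by `rfl`-unfolding modulo {BO(2), AL1}.

HONEST FRAMING: a reduction, not a proof of 3b′; BO(2) is crux-sized lattice semiclassics; femto rung R2b1 only; not a gap, not Clay.
No definitions, no new named facts.
-/

set_option autoImplicit false

noncomputable section

open MeasureTheory Filter Topology Real
open Literature.MathematicalPhysics.QuantumFieldTheory
open Literature.MathematicalPhysics.QuantumLattice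
open Literature.Analysis.OperatorTheory.YMMatrixModel

namespace Summit.QuantumFields.YangMills.Theorems.FemtoTransferGap

namespace BOHandover

/-! ## The reductions: 3b′ `CoarseNoIntruderAt L0` and `CoarseLowerAt L0` from BO(L0) and ONE -/

set_option maxHeartbeats 400000 in
/-- ★ **3b′ from BO and ONE: `BO(L0) → OneSiteLevels → CoarseNoIntruderAt L0`** (conclusion = the verbatim body of
`KTCoarseHandover.CoarseNoIntruderAt L0`, line «KTR» rev 3 part 1).  Given `d < Δ_k`, put `g = Δ_k − d`, take BO at `ε = g/4`, ONE at the
natural coupling `B' = L0³β` (`μ_k ≤ e^{−(Δ_k λ_b' − Cλ_b'²)} μ_0`), cancel `μ_0 > 0`, and convert `λ_b' ∈ [λ/((1+η)L0), λ/L0]`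
(`η = g/(4(|d|+1))`, label lemmas) — the slack `(3g/4)λ_b'` absorbs `Cλ_b'²` and the label mismatch once `lam` is small.
[cite: Luscher1983, §3] [cite: LuscherMunster1984, §2] -/
theorem coarseNoIntruderAt_of_boUpper (L0 : ℕ) [NeZero L0]
    (hBO : ∀ k : ℕ, ∀ ε : ℝ, 0 < ε → ∃ β0 : ℝ, ∀ β : ℝ, β0 ≤ β →
      levelValue su2Rep L0 β k * levelValue su2Rep 1 ((L0 : ℝ) ^ 3 * β) 0 ≤
        Real.exp (ε * bareLambda ((L0 : ℝ) ^ 3 * β)) *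
          (levelValue su2Rep 1 ((L0 : ℝ) ^ 3 * β) k * levelValue su2Rep L0 β 0))
    (hOne : Summit.QuantumFields.YangMills.Theses.LuscherReduction.OneSiteLevels) :
    ∀ k : ℕ, ∀ d : ℝ, d < levelGap k → ∃ lam0 : ℝ, 0 < lam0 ∧ ∀ lam : ℝ, 0 < lam → lam ≤ lam0 →
      ∀ β : ℝ, InFemtoWindow lam β L0 →
        levelValue su2Rep L0 β k ≤ Real.exp (-(d * luscherLambda β L0) / L0) * levelValue su2Rep L0 β 0 := by
  intro k d hd
  set g : ℝ := levelGap k - d with hg_def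
  have hg : 0 < g := by rw [hg_def]; linarith
  set η : ℝ := g / (4 * (|d| + 1)) with hη_def
  have hη : 0 < η := by rw [hη_def]; positivity
  have hdη : |d| * η ≤ g / 4 := by
    rw [hη_def]
    have ha : 0 ≤ |d| := abs_nonneg d
    rw [show |d| * (g / (4 * (|d| + 1))) = g / 4 * (|d| / (|d| + 1)) by field_simp]
    have : |d| / (|d| + 1) ≤ 1 := by rw [div_le_one (by positivity)]; linarith
    nlinarith
  obtain ⟨C, B0, H₁⟩ := hOne k
  obtain ⟨β0, H₂⟩ := hBO k (g / 4) (by positivity)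
  obtain ⟨β₁, H₃⟩ := exists_luscherLambda_le_mul_bareLambda L0 hη
  -- thresholds
  set M : ℝ := max 1 (max β0 (max B0 β₁)) with hM_def
  have hM1 : 1 ≤ M := le_max_left _ _
  have hMβ0 : β0 ≤ M := (le_max_left _ _).trans (le_max_right _ _)
  have hMB0 : B0 ≤ M := ((le_max_left _ _).trans (le_max_right _ _)).trans (le_max_right _ _)
  have hMβ1 : β₁ ≤ M := ((le_max_right _ _).trans (le_max_right _ _)).trans (le_max_right _ _)
  have hA : 0 < |C| + 1 := by positivity
  refine ⟨min 1 (min (1 / (4 * M)) (g / (4 * (|C| + 1)))),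
    lt_min one_pos (lt_min (by positivity) (by positivity)), ?_⟩
  intro lam hlam hle β hw
  have hlam1 : lam ≤ 1 := hle.trans (min_le_left _ _)
  have hleM : lam ≤ 1 / (4 * M) := (hle.trans (min_le_right _ _)).trans (min_le_left _ _)
  have hleg : lam ≤ g / (4 * (|C| + 1)) := (hle.trans (min_le_right _ _)).trans (min_le_right _ _)
  have hβ1 : 1 ≤ β := hw.1
  have hβ0' : 0 < β := by linarith
  have hβM : M ≤ β := (le_of_small_lam hM1 hlam hlam1 hleM).trans (beta_ge_of_window hlam hw)
  have hL0pos : (0 : ℝ) < L0 := Nat.cast_pos.mpr (NeZero.pos L0)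
  have hL0one : (1 : ℝ) ≤ L0 := by exact_mod_cast NeZero.one_le
  -- the natural one-site coupling `B' = L0³ β ≥ B0`
  set B' : ℝ := (L0 : ℝ) ^ 3 * β with hB'_def
  have hB'β : β ≤ B' := by
    rw [hB'_def]
    have : (1 : ℝ) ≤ (L0 : ℝ) ^ 3 := one_le_pow₀ hL0one
    nlinarith
  have hB0 : B0 ≤ B' := (hMB0.trans hβM).trans hB'β
  -- the three inputs
  obtain ⟨hu0, hU, -⟩ := H₁ B' hB0
  have hbo := H₂ β (hMβ0.trans hβM)
  have hl : 0 < luscherLambda β L0 := luscherLambda_pos_of_window hlam hw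
  have hlab_lo := mul_bareLambda_le_luscherLambda hβ1 L0 hl
  have hlab_hi := H₃ β (hMβ1.trans hβM) hl
  -- names
  set m : ℝ := bareLambda B' with hm_def
  have hmL : (L0 : ℝ) * m = (L0 : ℝ) * bareLambda ((L0 : ℝ) ^ 3 * β) := by rw [hm_def]
  set t : ℝ := luscherLambda β L0 / L0 with ht_def
  have hm0 : 0 ≤ m := by rw [hm_def]; unfold bareLambda; exact Real.rpow_nonneg (by positivity) _
  have hmt : m ≤ t := by
    rw [ht_def, le_div_iff₀ hL0pos, mul_comm]; exact hlab_lo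
  have htm : t ≤ (1 + η) * m := by
    rw [ht_def, div_le_iff₀ hL0pos]
    calc luscherLambda β L0 ≤ (1 + η) * ((L0 : ℝ) * bareLambda ((L0 : ℝ) ^ 3 * β)) := hlab_hi
      _ = (1 + η) * m * L0 := by rw [← hmL]; ring
  have htl : t ≤ luscherLambda β L0 := by
    rw [ht_def]; exact div_le_self hl.le hL0one
  have hm2 : m ≤ 2 * lam := (hmt.trans htl).trans hw.2.2
  have hCm : C * m ≤ g / 2 := by
    have h1 : C * m ≤ |C| * m := mul_le_mul_of_nonneg_right (le_abs_self C) hm0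
    have h2 : |C| * (2 * lam) ≤ |C| * (2 * (g / (4 * (|C| + 1)))) := by
      apply mul_le_mul_of_nonneg_left _ (abs_nonneg C); linarith
    have h3 : |C| * (2 * (g / (4 * (|C| + 1)))) = g / 2 * (|C| / (|C| + 1)) := by field_simp; ring
    have h4 : |C| / (|C| + 1) ≤ 1 := by rw [div_le_one hA]; linarith
    calc C * m ≤ |C| * m := h1
      _ ≤ |C| * (2 * lam) := mul_le_mul_of_nonneg_left hm2 (abs_nonneg C)
      _ ≤ g / 2 * (|C| / (|C| + 1)) := by rw [← h3]; exact h2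
      _ ≤ g / 2 * 1 := by apply mul_le_mul_of_nonneg_left h4; positivity
      _ = g / 2 := mul_one _
  -- the chain, cancelling `u0 > 0`
  set yk := levelValue su2Rep L0 β k with hyk_def
  set y0 := levelValue su2Rep L0 β 0 with hy0_def
  set uk := levelValue su2Rep 1 B' k with huk_def
  set u0 := levelValue su2Rep 1 B' 0 with hu0_def
  have hy0 : 0 < y0 := levelValue_zero_su2Rep_pos L0 β
  have key : yk * u0 ≤ (Real.exp (g / 4 * m) * Real.exp (-(levelGap k * m - C * m ^ 2))) * y0 * u0 := by
    calc yk * u0 ≤ Real.exp (g / 4 * m) * (uk * y0) := hbo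
      _ ≤ Real.exp (g / 4 * m) * ((Real.exp (-(levelGap k * m - C * m ^ 2)) * u0) * y0) :=
          mul_le_mul_of_nonneg_left (mul_le_mul_of_nonneg_right hU hy0.le) (Real.exp_pos _).le
      _ = (Real.exp (g / 4 * m) * Real.exp (-(levelGap k * m - C * m ^ 2))) * y0 * u0 := by ring
  have key2 : yk ≤ (Real.exp (g / 4 * m) * Real.exp (-(levelGap k * m - C * m ^ 2))) * y0 :=
    le_of_mul_le_mul_right key hu0
  have hexp : Real.exp (g / 4 * m) * Real.exp (-(levelGap k * m - C * m ^ 2)) ≤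
      Real.exp (-(d * luscherLambda β L0) / L0) := by
    rw [← Real.exp_add]
    apply Real.exp_le_exp.mpr
    have hΔ : levelGap k = d + g := by rw [hg_def]; ring
    have hrhs : -(d * luscherLambda β L0) / (L0 : ℝ) = -(d * t) := by rw [ht_def]; ring
    rw [hΔ, hrhs]
    have := exponent_upper_le (d := d) (C := C) hdη hCm hm0 hmt htm
    linarith
  exact key2.trans (mul_le_mul_of_nonneg_right hexp hy0.le)

/-- **3b′ modulo {BO(L0), AL1}**: with the tree's conditional closure of crux ONE from the named fact AL1 (`oneSiteLevels_of_AL1`, p493257).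
[cite: Luscher1983, §3] [cite: ReedSimonIV1978, Thm. XIII.64] -/
theorem coarseNoIntruderAt_of_boUpper_AL1 (L0 : ℕ) [NeZero L0]
    (hBO : ∀ k : ℕ, ∀ ε : ℝ, 0 < ε → ∃ β0 : ℝ, ∀ β : ℝ, β0 ≤ β →
      levelValue su2Rep L0 β k * levelValue su2Rep 1 ((L0 : ℝ) ^ 3 * β) 0 ≤
        Real.exp (ε * bareLambda ((L0 : ℝ) ^ 3 * β)) *
          (levelValue su2Rep 1 ((L0 : ℝ) ^ 3 * β) k * levelValue su2Rep L0 β 0))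
    (hAL1 : ∀ k : ℕ, LuscherHamiltonianEigenfunctions k) :
    ∀ k : ℕ, ∀ d : ℝ, d < levelGap k → ∃ lam0 : ℝ, 0 < lam0 ∧ ∀ lam : ℝ, 0 < lam → lam ≤ lam0 →
      ∀ β : ℝ, InFemtoWindow lam β L0 →
        levelValue su2Rep L0 β k ≤ Real.exp (-(d * luscherLambda β L0) / L0) * levelValue su2Rep L0 β 0 :=
  coarseNoIntruderAt_of_boUpper L0 hBO (oneSiteLevels_of_AL1 hAL1)

set_option maxHeartbeats 400000 in
/-- ★ **The converse-direction twin: `BO_lower(L0) → OneSiteLevels → CoarseLowerAt L0`** (conclusion = the verbatim body of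
`KTCoarseHandover.CoarseLowerAt L0`).  BO_lower is the trial-function direction of Born–Oppenheimer
(`μ_k(L0³β) · λ_0(L0,β) ≤ e^{ε λ_b'} λ_k(L0,β) · μ_0(L0³β)`); ONE's lower half `e^{−(Δ_kλ_b' + Cλ_b'²)} μ_0 ≤ μ_k` and the lower label
bound `λ_b' ≤ λ/L0` (no upper bound is needed since `Δ_k ≥ 0`) give `e^{−(Δ_k+ε₀)λ/L0} λ_0 ≤ λ_k`.
[cite: Luscher1983, §3] [cite: LuscherMunster1984, §2] -/
theorem coarseLowerAt_of_boLower (L0 : ℕ) [NeZero L0]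
    (hBO : ∀ k : ℕ, ∀ ε : ℝ, 0 < ε → ∃ β0 : ℝ, ∀ β : ℝ, β0 ≤ β →
      levelValue su2Rep 1 ((L0 : ℝ) ^ 3 * β) k * levelValue su2Rep L0 β 0 ≤
        Real.exp (ε * bareLambda ((L0 : ℝ) ^ 3 * β)) *
          (levelValue su2Rep L0 β k * levelValue su2Rep 1 ((L0 : ℝ) ^ 3 * β) 0))
    (hOne : Summit.QuantumFields.YangMills.Theses.LuscherReduction.OneSiteLevels) :
    ∀ k : ℕ, ∀ ε : ℝ, 0 < ε → ∃ lam0 : ℝ, 0 < lam0 ∧ ∀ lam : ℝ, 0 < lam → lam ≤ lam0 →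
      ∀ β : ℝ, InFemtoWindow lam β L0 →
        Real.exp (-((levelGap k + ε) * luscherLambda β L0) / L0) * levelValue su2Rep L0 β 0 ≤ levelValue su2Rep L0 β k := by
  intro k ε₀ hε₀
  have hΔ : 0 ≤ levelGap k := physLevel_succ_sub_nonneg k
  obtain ⟨C, B0, H₁⟩ := hOne k
  obtain ⟨β0, H₂⟩ := hBO k (ε₀ / 2) (by positivity)
  set M : ℝ := max 1 (max β0 B0) with hM_def
  have hM1 : 1 ≤ M := le_max_left _ _
  have hMβ0 : β0 ≤ M := (le_max_left _ _).trans (le_max_right _ _)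
  have hMB0 : B0 ≤ M := (le_max_right _ _).trans (le_max_right _ _)
  have hA : 0 < |C| + 1 := by positivity
  refine ⟨min 1 (min (1 / (4 * M)) (ε₀ / (4 * (|C| + 1)))),
    lt_min one_pos (lt_min (by positivity) (by positivity)), ?_⟩
  intro lam hlam hle β hw
  have hlam1 : lam ≤ 1 := hle.trans (min_le_left _ _)
  have hleM : lam ≤ 1 / (4 * M) := (hle.trans (min_le_right _ _)).trans (min_le_left _ _)
  have hleg : lam ≤ ε₀ / (4 * (|C| + 1)) := (hle.trans (min_le_right _ _)).trans (min_le_right _ _)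
  have hβ1 : 1 ≤ β := hw.1
  have hβ0' : 0 < β := by linarith
  have hβM : M ≤ β := (le_of_small_lam hM1 hlam hlam1 hleM).trans (beta_ge_of_window hlam hw)
  have hL0pos : (0 : ℝ) < L0 := Nat.cast_pos.mpr (NeZero.pos L0)
  have hL0one : (1 : ℝ) ≤ L0 := by exact_mod_cast NeZero.one_le
  set B' : ℝ := (L0 : ℝ) ^ 3 * β with hB'_def
  have hB'β : β ≤ B' := by
    rw [hB'_def]
    have : (1 : ℝ) ≤ (L0 : ℝ) ^ 3 := one_le_pow₀ hL0one
    nlinarith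
  have hB0 : B0 ≤ B' := (hMB0.trans hβM).trans hB'β
  obtain ⟨hu0, -, hL⟩ := H₁ B' hB0
  have hbo := H₂ β (hMβ0.trans hβM)
  have hl : 0 < luscherLambda β L0 := luscherLambda_pos_of_window hlam hw
  have hlab_lo := mul_bareLambda_le_luscherLambda hβ1 L0 hl
  set m : ℝ := bareLambda B' with hm_def
  have hmL : (L0 : ℝ) * m = (L0 : ℝ) * bareLambda ((L0 : ℝ) ^ 3 * β) := by rw [hm_def]
  set t : ℝ := luscherLambda β L0 / L0 with ht_def
  have hm0 : 0 ≤ m := by rw [hm_def]; unfold bareLambda; exact Real.rpow_nonneg (by positivity) _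
  have hmt : m ≤ t := by
    rw [ht_def, le_div_iff₀ hL0pos, mul_comm]; exact hlab_lo
  have htl : t ≤ luscherLambda β L0 := by
    rw [ht_def]; exact div_le_self hl.le hL0one
  have hm2 : m ≤ 2 * lam := (hmt.trans htl).trans hw.2.2
  have hCm : C * m ≤ ε₀ / 2 := by
    have h1 : C * m ≤ |C| * m := mul_le_mul_of_nonneg_right (le_abs_self C) hm0
    have h2 : |C| * (2 * lam) ≤ |C| * (2 * (ε₀ / (4 * (|C| + 1)))) := by
      apply mul_le_mul_of_nonneg_left _ (abs_nonneg C); linarith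
    have h3 : |C| * (2 * (ε₀ / (4 * (|C| + 1)))) = ε₀ / 2 * (|C| / (|C| + 1)) := by field_simp; ring
    have h4 : |C| / (|C| + 1) ≤ 1 := by rw [div_le_one hA]; linarith
    calc C * m ≤ |C| * m := h1
      _ ≤ |C| * (2 * lam) := mul_le_mul_of_nonneg_left hm2 (abs_nonneg C)
      _ ≤ ε₀ / 2 * (|C| / (|C| + 1)) := by rw [← h3]; exact h2
      _ ≤ ε₀ / 2 * 1 := by apply mul_le_mul_of_nonneg_left h4; positivity
      _ = ε₀ / 2 := mul_one _
  set yk := levelValue su2Rep L0 β k with hyk_def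
  set y0 := levelValue su2Rep L0 β 0 with hy0_def
  set uk := levelValue su2Rep 1 B' k with huk_def
  set u0 := levelValue su2Rep 1 B' 0 with hu0_def
  have hy0 : 0 < y0 := levelValue_zero_su2Rep_pos L0 β
  have hyk : 0 ≤ yk := levelValue_su2Rep_nonneg L0 (zero_le_one.trans hβ1) k
  -- `(e^{-(Δ m + C m²)} u0) y0 ≤ uk y0 ≤ e^{ε₀/2 m} yk u0`
  have key : (Real.exp (-(levelGap k * m + C * m ^ 2)) * y0) * u0 ≤ (Real.exp (ε₀ / 2 * m) * yk) * u0 := by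
    calc (Real.exp (-(levelGap k * m + C * m ^ 2)) * y0) * u0
        = (Real.exp (-(levelGap k * m + C * m ^ 2)) * u0) * y0 := by ring
      _ ≤ uk * y0 := mul_le_mul_of_nonneg_right hL hy0.le
      _ ≤ Real.exp (ε₀ / 2 * m) * (yk * u0) := hbo
      _ = (Real.exp (ε₀ / 2 * m) * yk) * u0 := by ring
  have key2 : Real.exp (-(levelGap k * m + C * m ^ 2)) * y0 ≤ Real.exp (ε₀ / 2 * m) * yk :=
    le_of_mul_le_mul_right key hu0
  have key3 : Real.exp (-(levelGap k * m + C * m ^ 2) - ε₀ / 2 * m) * y0 ≤ yk := by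
    have hE : Real.exp (-(levelGap k * m + C * m ^ 2) - ε₀ / 2 * m) =
        Real.exp (-(levelGap k * m + C * m ^ 2)) / Real.exp (ε₀ / 2 * m) := by
      rw [Real.exp_sub]
    rw [hE, div_mul_eq_mul_div, div_le_iff₀ (Real.exp_pos _)]
    calc Real.exp (-(levelGap k * m + C * m ^ 2)) * y0 ≤ Real.exp (ε₀ / 2 * m) * yk := key2
      _ = yk * Real.exp (ε₀ / 2 * m) := by ring
  have hexp : Real.exp (-((levelGap k + ε₀) * luscherLambda β L0) / L0) ≤
      Real.exp (-(levelGap k * m + C * m ^ 2) - ε₀ / 2 * m) := by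
    apply Real.exp_le_exp.mpr
    have hrhs : -((levelGap k + ε₀) * luscherLambda β L0) / (L0 : ℝ) = -((levelGap k + ε₀) * t) := by
      rw [ht_def]; ring
    rw [hrhs]
    exact exponent_lower_le hΔ hε₀ hCm hm0 hmt
  exact (mul_le_mul_of_nonneg_right hexp hy0.le).trans key3

/-- **`CoarseLowerAt L0` modulo {BO_lower(L0), AL1}** (via `oneSiteLevels_of_AL1`, p493257).
[cite: Luscher1983, §3] [cite: ReedSimonIV1978, Thm. XIII.64] -/
theorem coarseLowerAt_of_boLower_AL1 (L0 : ℕ) [NeZero L0]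
    (hBO : ∀ k : ℕ, ∀ ε : ℝ, 0 < ε → ∃ β0 : ℝ, ∀ β : ℝ, β0 ≤ β →
      levelValue su2Rep 1 ((L0 : ℝ) ^ 3 * β) k * levelValue su2Rep L0 β 0 ≤
        Real.exp (ε * bareLambda ((L0 : ℝ) ^ 3 * β)) *
          (levelValue su2Rep L0 β k * levelValue su2Rep 1 ((L0 : ℝ) ^ 3 * β) 0))
    (hAL1 : ∀ k : ℕ, LuscherHamiltonianEigenfunctions k) :
    ∀ k : ℕ, ∀ ε : ℝ, 0 < ε → ∃ lam0 : ℝ, 0 < lam0 ∧ ∀ lam : ℝ, 0 < lam → lam ≤ lam0 →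
      ∀ β : ℝ, InFemtoWindow lam β L0 →
        Real.exp (-((levelGap k + ε) * luscherLambda β L0) / L0) * levelValue su2Rep L0 β 0 ≤ levelValue su2Rep L0 β k :=
  coarseLowerAt_of_boLower L0 hBO (oneSiteLevels_of_AL1 hAL1)

end BOHandover

end Summit.QuantumFields.YangMills.Theorems.FemtoTransferGap

end
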